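import Literature.Barriers.HubbardSuperconductivity.StrongCouplingCeilingProofs
import Literature.MathematicalPhysics.QuantumLattice.HubbardGapBounds
import HarnessLib

/-!
# Discharge of the narrowed barrier `StrongCouplingCeilingNarrow` (Ueltschi 1999, Theorem 3.1 on `D₁ ∪ D₂`)

Sibling proof file of `Literature/Barriers/HubbardSuperconductivity/StrongCouplingCeiling.lean`:
`theorem StrongCouplingCeilingNarrow_holds : StrongCouplingCeilingNarrow`, the audited kernel of the
strong-coupling ceiling on BOTH printed domains. Constants (not optimised):
`ε = min(τ₀, (8(1+ϱ))⁻¹)`, `c = (16(1+ϱ)²)⁻¹` with `τ₀ = (4e⁶·2178)⁻¹` (`HubbardLatticeActivity.tau0`)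
and `ϱ = 2178 e⁹` (`HubbardGapBounds.gapRho`).

* `D₁ = {βt < ε}`: the tree theorem `StrongCouplingCeiling_holds` (`StrongCouplingCeilingProofs`:
  `freeEnergy_eq`, `tendsto_boxFreeEnergy`, `analyticAt_freeEnergy`).
* `D₂ = {0 < μ < U, 2t < εΔ, βt² < c(Δ - 2t/ε)}`, `Δ = min(μ, U - μ)`: the same cluster-expansion
  pipeline (polymer representation of the box partition function, Kotecký–Preiss, thermodynamic
  limit and several-variable analyticity of the polymer pressure), run with the smallness of the
  lattice activity in the GAPPED regime (`HubbardGapBounds`: `isSmallTIActivity_latticeActivity_of_gap`,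
  `admissibleSetGap`, `analyticOnNhd_polymerPressure_lattice_gap`), where `βt` may be arbitrarily
  large (`StrongCouplingCeilingNarrow.exists_large_beta_t`). The three free-energy statements are
  first proved from smallness alone (`boxFreeEnergy_eq_of_small`, `tendsto_boxFreeEnergy_of_small`,
  `freeEnergy_eq_of_small`), then specialised (`analyticAt_freeEnergy_of_gap`).

Deviation from the printed proof (recorded in `HubbardGapBounds`): Ueltschi controls `D₂` by a
space–time loop representation of the Duhamel expansion; the tree's inclusion–exclusion weights are
bounded instead through a comparison semigroup and a Lyapunov vector, with the same domain shape
(`t/Δ` and `βt²/Δ` small). Everything is PROVED; no statement of the barrier file is changed and no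
definition is introduced here.

## References

* D. Ueltschi, J. Stat. Phys. 95 (1999) 693–717, arXiv:cond-mat/9810320, Theorem 3.1 (domains
  `D₁`, `D₂`) with Theorem 2.1 (i), Proposition 2.2, §3. [Ueltschi1999]
* R. Kotecký, D. Preiss, Comm. Math. Phys. 103 (1986) 491. [KoteckyPreiss1986]
-/

noncomputable section

namespace Literature.Barriers.HubbardSuperconductivity

open Filter Literature.MathematicalPhysics.QuantumLattice Literature.Probability.LatticeModels
open scoped _root_.Topology

variable {t U μ β : ℝ}

/-! ### The free energy from a small activity (both domains) -/

/-- **The finite-volume free energy through the cluster expansion**, assuming only the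
Kotecký–Preiss smallness of the lattice activity at the real point:
`f_L(t,U,μ,β) = -β⁻¹ (log z₀ + Re (log Ξ_L / |Λ_L|))`. [cite: Ueltschi1999, proof of Theorem 2.1 (i) (Tr e^{-βH_Λ} = e^{-βf₀|Λ|} Σ Π ρ; log by Proposition 2.2)] -/
theorem boxFreeEnergy_eq_of_small (hβ : 0 < β) (hsm : IsSmallTIActivity (rho t U β μ) 1) (L : ℕ) :
    boxFreeEnergy t U μ β L =
      -β⁻¹ * (Real.log (atomicPartitionFnReal β U μ) +
        (polymerLogZ polyInc (rho t U β μ) (box 2 L).powerset / ((box 2 L).card : ℂ)).re) := by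
  set Ξ := polymerPartitionFunction polyInc (rho t U β μ) (box 2 L).powerset with hΞ
  -- the KP logarithm is the real logarithm of `Ξ > 0`
  have hZ : ∀ s ∈ Set.Icc (0 : ℝ) 1, polymerPartitionFunction polyInc (fun A => (s : ℂ) * rho t U β μ A) (box 2 L).powerset ≠ 0 :=
    fun s hs => polymerPartitionFunction_ne_zero_of_kp ((isSmallTIActivity_smul hsm hs).isKPVolume _) Finset.Subset.rfl
  obtain ⟨hΞpos, hlog⟩ := polymerLogZ_eq_log_of_real (inc := polyInc) (rho_im_eq_zero t U β μ) hZ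
  -- the partition function of the box
  have hZbox : (hamiltonianWith (fermionBoxGraph 2 L) t U μ).partitionFn β =
      (((atomicPartitionFnReal β U μ ^ Fintype.card (FermionBox 2 L) * Ξ.re : ℝ)) : ℂ) := by
    have h : (hamiltonianWith (fermionBoxGraph 2 L) t U μ).partitionFn β =
        atomicPartitionFn β U μ ^ Fintype.card (FermionBox 2 L) * Ξ :=
      partitionFn_box_eq (d := 2) β t U μ L
    rw [atomicPartitionFn_ofReal] at h
    have hΞre : Ξ = ((Ξ.re : ℝ) : ℂ) := by
      apply Complex.ext
      · simp
      · rw [Complex.ofReal_im]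
        exact polymerPartitionFunction_im_eq_zero (inc := polyInc) (rho_im_eq_zero t U β μ) _
    rw [h]
    push_cast
    rw [← hΞre]
  have hz0 : 0 < atomicPartitionFnReal β U μ := atomicPartitionFnReal_pos β U μ
  have hN : Fintype.card (FermionBox 2 L) = (box 2 L).card := by rw [card_fermionBox_two, card_box]
  have hNpos : (0 : ℝ) < (box 2 L).card := by rw [card_box]; positivity
  rw [boxFreeEnergy_def, hZbox, Complex.ofReal_re, Real.log_mul (pow_pos hz0 _).ne' hΞpos.ne', Real.log_pow, hlog, hN,
    ← Complex.ofReal_natCast, ← Complex.ofReal_div, Complex.ofReal_re]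
  field_simp

/-- **Thermodynamic limit from smallness**: `f_L → -β⁻¹ (log z₀ + Re p(ρ_{β,μ}))`. [cite: Ueltschi1999, Theorem 3.1 with Theorem 2.1 (i) (existence of the free energy)] -/
theorem tendsto_boxFreeEnergy_of_small (hβ : 0 < β) (hsm : IsSmallTIActivity (rho t U β μ) 1) :
    Tendsto (fun L : ℕ => boxFreeEnergy t U μ β L) atTop (𝓝 (freeEnergyLimit t U μ β)) := by
  have hlim := hsm.tendsto_polymerLogZ_box_div_card (by norm_num : 1 ≤ 2)
  have hre := (Complex.continuous_re.tendsto _).comp hlim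
  rw [show (fun L : ℕ => boxFreeEnergy t U μ β L) = fun L => -β⁻¹ * (Real.log (atomicPartitionFnReal β U μ) +
      (polymerLogZ polyInc (rho t U β μ) (box 2 L).powerset / ((box 2 L).card : ℂ)).re) from
    funext fun L => boxFreeEnergy_eq_of_small hβ hsm L]
  exact (tendsto_const_nhds.add hre).const_mul _

/-- **The free energy from smallness** is `-β⁻¹ (log z₀(β,U,μ) + Re p(ρ_{β,μ}))`. [cite: Ueltschi1999, proof of Theorem 2.1 (i) (formula for f(β, μ))] -/
theorem freeEnergy_eq_of_small (hβ : 0 < β) (hsm : IsSmallTIActivity (rho t U β μ) 1) :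
    freeEnergy t U μ β = freeEnergyLimit t U μ β :=
  (tendsto_boxFreeEnergy_of_small hβ hsm).limUnder_eq

/-! ### The domain `D₂` -/

/-- In the gapped admissible domain the lattice activity at the real point is small.
[cite: Ueltschi1999, Theorem 3.1 (domain D₂) via Proposition 2.2] -/
theorem isSmallTIActivity_rho_of_gap (ht : 0 ≤ t) (h : ((β : ℂ), (μ : ℂ)) ∈ admissibleSetGap U t) :
    IsSmallTIActivity (rho t U β μ) 1 := by
  have h' := isSmallTIActivity_of_mem_admissibleSetGap (z := ((β : ℂ), (μ : ℂ))) ht h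
  dsimp only at h'
  exact h'

/-- **Real-analyticity of the free energy in `(β, μ)` in `D₂`.** [cite: Ueltschi1999, Theorem 3.1 (domain D₂: "Since the weights of polymers are analytic functions of β, μ, so is the free energy in the thermodynamic limit")] -/
theorem analyticAt_freeEnergy_of_gap (ht : 0 ≤ t) (hβ : 0 < β) (hmem : ((β : ℂ), (μ : ℂ)) ∈ admissibleSetGap U t) :
    AnalyticAt ℝ (fun p : ℝ × ℝ => freeEnergy t U p.2 p.1) (β, μ) := by
  -- the complex pressure and the real inclusion
  set P : ℂ × ℂ → ℂ := fun z => polymerPressure (latticeActivity 2 z.1 U z.2 (z.1 * t)) with hP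
  set ι : ℝ × ℝ →L[ℝ] ℂ × ℂ :=
    (Complex.ofRealCLM.comp (ContinuousLinearMap.fst ℝ ℝ ℝ)).prod (Complex.ofRealCLM.comp (ContinuousLinearMap.snd ℝ ℝ ℝ)) with hι
  have hιapp : ∀ q : ℝ × ℝ, ι q = ((q.1 : ℂ), (q.2 : ℂ)) := fun q => rfl
  have hPa : AnalyticAt ℂ P (ι (β, μ)) := by
    rw [hιapp]
    exact analyticOnNhd_polymerPressure_lattice_gap (U := U) ht _ hmem
  have hPι : AnalyticAt ℝ (fun q : ℝ × ℝ => P (ι q)) (β, μ) :=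
    AnalyticAt.comp (f := fun q : ℝ × ℝ => ι q) (x := (β, μ)) (hPa.restrictScalars (𝕜 := ℝ)) (ι.analyticAt _)
  have hRe : AnalyticAt ℝ (fun q : ℝ × ℝ => (P (ι q)).re) (β, μ) :=
    AnalyticAt.comp (f := fun q : ℝ × ℝ => P (ι q)) (x := (β, μ)) (Complex.reCLM.analyticAt _) hPι
  -- the explicit formula is analytic
  have hF : AnalyticAt ℝ (fun q : ℝ × ℝ => -q.1⁻¹ * (Real.log (atomicPartitionFnReal q.1 U q.2) + (P (ι q)).re)) (β, μ) := by
    have h1 : AnalyticAt ℝ (fun q : ℝ × ℝ => q.1⁻¹) (β, μ) := analyticAt_fst.inv hβ.ne'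
    have h2 : AnalyticAt ℝ (Real.log ∘ fun q : ℝ × ℝ => atomicPartitionFnReal q.1 U q.2) (β, μ) :=
      AnalyticAt.comp (f := fun q : ℝ × ℝ => atomicPartitionFnReal q.1 U q.2) (x := (β, μ))
        (analyticAt_log (atomicPartitionFnReal_pos β U μ)) (analyticAt_atomicPartitionFnReal U _)
    exact h1.neg.mul (h2.add hRe)
  -- and agrees with the free energy near `(β, μ)`
  refine hF.congr ?_
  have hcont : Continuous fun q : ℝ × ℝ => ι q := ι.continuous
  have hS : IsOpen ({q : ℝ × ℝ | 0 < q.1} ∩ (fun q : ℝ × ℝ => ι q) ⁻¹' admissibleSetGap U t) :=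
    (isOpen_lt continuous_const continuous_fst).inter ((isOpen_admissibleSetGap U t).preimage hcont)
  have hmem' : (β, μ) ∈ {q : ℝ × ℝ | 0 < q.1} ∩ (fun q : ℝ × ℝ => ι q) ⁻¹' admissibleSetGap U t := ⟨hβ, hmem⟩
  filter_upwards [hS.mem_nhds hmem'] with q hq
  have hq2 : ((q.1 : ℂ), (q.2 : ℂ)) ∈ admissibleSetGap U t := hq.2
  rw [freeEnergy_eq_of_small hq.1 (isSmallTIActivity_rho_of_gap ht hq2), freeEnergyLimit]
  rfl

/-- **Discharge of the narrowed barrier `StrongCouplingCeilingNarrow`** (Ueltschi 1999, Theorem 3.1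
on BOTH domains `D₁ ∪ D₂` with Theorem 2.1 (i); square lattice, free boundary conditions): with
`ε = min(τ₀, (8(1+ϱ))⁻¹)` and `c = (16(1+ϱ)²)⁻¹` (`τ₀ = (4e⁶·2178)⁻¹`, `ϱ = 2178 e⁹`), for
`t ≥ 0`, `β > 0` and either `βt < ε`, or `0 < μ < U`, `2t < εΔ`, `βt² < c(Δ - 2t/ε)`
(`Δ = min(μ, U-μ)`), the free energy density has a thermodynamic limit along `{-L,…,L}²` and is
jointly real-analytic in `(β, μ)`. The `D₁` branch is `StrongCouplingCeiling_holds`; in the `D₂`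
branch the smallness of the polymer weights at large `βt` comes from the gap
(`HubbardGapBounds`: comparison semigroup and Lyapunov vector in place of Ueltschi's space–time
loops, same domain shape `t/Δ`, `βt²/Δ` small). [cite: Ueltschi1999, Theorem 3.1 (domains D₁ and D₂) with Theorem 2.1 (i)] -/
theorem StrongCouplingCeilingNarrow_holds : StrongCouplingCeilingNarrow := by
  have hϱ : 0 < 1 + gapRho := by linarith [gapRho_pos]
  set ε : ℝ := min tau0 (8 * (1 + gapRho))⁻¹ with hε
  set c : ℝ := (16 * (1 + gapRho) ^ 2)⁻¹ with hc
  have hεpos : 0 < ε := lt_min tau0_pos (by positivity)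
  have hcpos : 0 < c := by positivity
  refine ⟨ε, hεpos, c, hcpos, fun t U μ β ht hβ hcl => ?_⟩
  rcases hcl with h1 | ⟨hμ, hμU, h2t, hβt⟩
  · -- domain `D₁`
    have hβt : β * t < tau0 := lt_of_lt_of_le h1 (min_le_left _ _)
    refine ⟨?_, analyticAt_freeEnergy ht hβ hβt U μ⟩
    rw [freeEnergy_eq ht hβ hβt U μ]
    exact tendsto_boxFreeEnergy ht hβ hβt U μ
  · -- domain `D₂`
    set Δ : ℝ := min μ (U - μ) with hΔ
    have hΔpos : 0 < Δ := lt_min hμ (by linarith)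
    have hA : (1 + gapRho) * 16 * t < Δ := by
      have hε8 : ε ≤ (8 * (1 + gapRho))⁻¹ := min_le_right _ _
      have h3 : 2 * t < (8 * (1 + gapRho))⁻¹ * Δ :=
        lt_of_lt_of_le h2t (mul_le_mul_of_nonneg_right hε8 hΔpos.le)
      have h4 : (8 * (1 + gapRho))⁻¹ * Δ * (8 * (1 + gapRho)) = Δ := by field_simp
      nlinarith
    have hB : (1 + gapRho) ^ 2 * 16 * (β * t ^ 2) < Δ := by
      have h3 : β * t ^ 2 < c * Δ := by
        refine lt_of_lt_of_le hβt (mul_le_mul_of_nonneg_left ?_ hcpos.le)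
        have : 0 ≤ 2 * t / ε := by positivity
        linarith
      have h4 : c * Δ * (16 * (1 + gapRho) ^ 2) = Δ := by rw [hc]; field_simp
      have hpos : 0 < 16 * (1 + gapRho) ^ 2 := by positivity
      have h5 := mul_lt_mul_of_pos_right h3 hpos
      rw [h4] at h5
      calc (1 + gapRho) ^ 2 * 16 * (β * t ^ 2) = β * t ^ 2 * (16 * (1 + gapRho) ^ 2) := by ring
        _ < Δ := h5
    have hmem : ((β : ℂ), (μ : ℂ)) ∈ admissibleSetGap U t := mem_admissibleSetGap_of_real hβ hμ hμU hA hB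
    have hsm := isSmallTIActivity_rho_of_gap ht hmem
    refine ⟨?_, analyticAt_freeEnergy_of_gap ht hβ hmem⟩
    rw [freeEnergy_eq_of_small hβ hsm]
    exact tendsto_boxFreeEnergy_of_small hβ hsm

end Literature.Barriers.HubbardSuperconductivity

end
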